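import Summits.AtomisticToContinuum.Crystallization.Theorems.PricedLinkCensusChargedPeriodicIsOptimalPacking

/-!
# Bondedness of Lennard-Jones ground states (helper for `HullGoodEverywhere`,
# route `HullExactificationCascade`, item stmt-AtomisticToContinuum-12089)

Every particle of a Lennard-Jones ground state with at least two particles has another particle
within a UNIFORM distance `R₀` (independent of `N`).  Standard relocation argument: if all other
particles are farther than `R₀` from `xᵢ`, the site energy of `i` is `≥ -(250/6) δ⁻⁵ R₀⁻¹`
(attractive tail, shells counted by the packing bound at the uniform minimal distance `δ` of
`LennardJonesMinimalDistance_holds`), whereas moving `xᵢ` next to the particle with the largest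
first coordinate (at distance exactly `1`, all other particles at distance `≥ 1`, where
`V_LJ ≤ 0`) gives site energy `≤ V_LJ(1) = -1/12`; for `R₀ > 500 δ⁻⁵` the move lowers the energy.

Contents: `hge_siteEnergy_ge_of_far` (tail bound for an isolated particle, via the tree's shell sum
`ChargedPeriodicOptimal.sum_inv_pow_five_le`), `hge_sum_lennardJones_relocate_le` (the trial
position), `hge_exists_bond_radius` (the bondedness theorem).
-/

noncomputable section

open scoped BigOperators
open Metric Set

namespace Summit.AtomisticToContinuum.Crystallization.Theorems

open Literature.MathematicalPhysics.StatisticalMechanics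

/-- **Tail bound for an isolated particle.** If all mutual distances in `x` are `≥ r > 0` and all
particles other than `i` are at distance `≥ R > 0` from `xᵢ`, then the Lennard-Jones site energy
of `i` is `≥ -(1/6) · R⁻¹ · 250 r⁻⁵` (`V_LJ(s) ≥ -s⁻⁶/6 ≥ -R⁻¹ s⁻⁵/6`, then the shell sum).
[folklore] -/
theorem hge_siteEnergy_ge_of_far {N : ℕ} (x : Fin N → (EuclideanSpace ℝ (Fin 3))) {r R : ℝ} (hr : 0 < r) (hR : 0 < R)
    (hsep : ∀ k l, k ≠ l → r ≤ dist (x k) (x l)) (i : Fin N)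
    (hfar : ∀ k, k ≠ i → R ≤ dist (x i) (x k)) :
    -((1 / 6) * (R⁻¹ * (250 * r⁻¹ ^ 5))) ≤ siteEnergy lennardJones x i := by
  have h5 := ChargedPeriodicOptimal.sum_inv_pow_five_le x hr hsep i
  have hterm : ∀ k ∈ Finset.univ.erase i,
      -((1 / 6) * (R⁻¹ * (dist (x i) (x k))⁻¹ ^ 5)) ≤ lennardJones (dist (x i) (x k)) := by
    intro k hk
    have hki : k ≠ i := Finset.ne_of_mem_erase hk
    have hd : R ≤ dist (x i) (x k) := hfar k hki
    have hd0 : 0 < dist (x i) (x k) := hR.trans_le hd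
    set s := dist (x i) (x k) with hs
    have h0 : 0 ≤ s⁻¹ := inv_nonneg.2 hd0.le
    have h1 : s⁻¹ ≤ R⁻¹ := inv_anti₀ hR hd
    have h6 : (s⁻¹) ^ 6 ≤ R⁻¹ * (s⁻¹) ^ 5 := by
      calc (s⁻¹) ^ 6 = s⁻¹ * (s⁻¹) ^ 5 := by ring
        _ ≤ R⁻¹ * (s⁻¹) ^ 5 := mul_le_mul_of_nonneg_right h1 (pow_nonneg h0 5)
    unfold lennardJones
    nlinarith [pow_nonneg h0 12]
  calc -((1 / 6) * (R⁻¹ * (250 * r⁻¹ ^ 5)))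
      ≤ -((1 / 6) * (R⁻¹ * ∑ k ∈ Finset.univ.erase i, (dist (x i) (x k))⁻¹ ^ 5)) := by
        have hR' : 0 ≤ R⁻¹ := inv_nonneg.2 hR.le
        nlinarith [mul_le_mul_of_nonneg_left h5 hR']
    _ = ∑ k ∈ Finset.univ.erase i, -((1 / 6) * (R⁻¹ * (dist (x i) (x k))⁻¹ ^ 5)) := by
        rw [Finset.mul_sum, Finset.mul_sum, ← Finset.sum_neg_distrib]
    _ ≤ ∑ k ∈ Finset.univ.erase i, lennardJones (dist (x i) (x k)) := Finset.sum_le_sum hterm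
    _ = siteEnergy lennardJones x i := rfl

/-- **The trial position.** Let `i ≠ m` be particles of a configuration `x` of `ℝ³` such that
`x_m` has the largest first coordinate among the particles other than `i`, and put
`y := x_m + e₁`.  Then `y` is at distance exactly `1` from `x_m` and at distance `≥ 1` from every
other particle `x_k`, `k ≠ i`; hence `∑_{k ≠ i} V_LJ(|y - x_k|) ≤ V_LJ(1) = -1/12` and `y ≠ x_k`
for `k ≠ i`. [folklore] -/
theorem hge_sum_lennardJones_relocate_le {N : ℕ} (x : Fin N → (EuclideanSpace ℝ (Fin 3))) {i m : Fin N} (hmi : m ≠ i)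
    (hmax : ∀ k, k ≠ i → x k 0 ≤ x m 0) :
    (∑ k ∈ Finset.univ.erase i,
        lennardJones (dist (x m + EuclideanSpace.single 0 1) (x k)) ≤ -1 / 12) ∧
      ∀ k, k ≠ i → 1 ≤ dist (x m + EuclideanSpace.single 0 1) (x k) := by
  set y : (EuclideanSpace ℝ (Fin 3)) := x m + EuclideanSpace.single 0 1 with hy
  have hfar : ∀ k, k ≠ i → 1 ≤ dist y (x k) := by
    intro k hki
    have h1 : (y - x k) 0 = x m 0 + 1 - x k 0 := by
      simp [hy]
    have h2 : |(y - x k) 0| ≤ ‖y - x k‖ := by simpa using PiLp.norm_apply_le (y - x k) 0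
    rw [dist_eq_norm]
    have h3 : 1 ≤ (y - x k) 0 := by rw [h1]; linarith [hmax k hki]
    exact le_trans (h3.trans (le_abs_self _)) h2
  refine ⟨?_, hfar⟩
  have hm : m ∈ Finset.univ.erase i := Finset.mem_erase.2 ⟨hmi, Finset.mem_univ _⟩
  rw [← Finset.add_sum_erase _ _ hm]
  have hdm : dist y (x m) = 1 := by
    rw [hy, dist_eq_norm, add_sub_cancel_left, PiLp.norm_single, norm_one]
  have hrest : ∑ k ∈ (Finset.univ.erase i).erase m, lennardJones (dist y (x k)) ≤ 0 :=
    Finset.sum_nonpos fun k hk =>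
      lennardJones_nonpos (hfar k (Finset.ne_of_mem_erase (Finset.mem_of_mem_erase hk)))
  rw [hdm, lennardJones_one]
  linarith

/-- **Bondedness of Lennard-Jones ground states.** There is `R₀ > 0` such that in every
Lennard-Jones ground state in `ℝ³` with at least two particles, every particle has another
particle within distance `R₀`.  (Otherwise relocate the isolated particle next to the particle of
largest first coordinate: the site energy drops from `≥ -(250/6) δ⁻⁵ R₀⁻¹ > -1/12` to `≤ -1/12`
while all other pair terms are unchanged, contradicting minimality; `δ` is the uniform minimal
distance `LennardJonesMinimalDistance_holds`.) [folklore] -/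
theorem hge_exists_bond_radius : ∃ R₀ : ℝ, 0 < R₀ ∧ ∀ (N : ℕ) (x : Fin N → (EuclideanSpace ℝ (Fin 3))),
    IsGroundState lennardJones x → ∀ i j : Fin N, j ≠ i →
      ∃ k : Fin N, k ≠ i ∧ dist (x i) (x k) ≤ R₀ := by
  classical
  obtain ⟨δ, hδ, hsepall⟩ := LennardJonesMinimalDistance_holds
  refine ⟨500 * δ⁻¹ ^ 5 + 1, by positivity, fun N x hx i j hji => ?_⟩
  by_contra hcon
  push Not at hcon
  set R₀ : ℝ := 500 * δ⁻¹ ^ 5 + 1 with hR₀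
  have hR₀0 : 0 < R₀ := by positivity
  have hsep : ∀ k l, k ≠ l → δ ≤ dist (x k) (x l) := hsepall N x hx
  -- lower bound on the site energy of the isolated particle
  have hlow := hge_siteEnergy_ge_of_far x hδ hR₀0 hsep i fun k hk => (hcon k hk).le
  have htail : (1 / 6) * (R₀⁻¹ * (250 * δ⁻¹ ^ 5)) < 1 / 12 := by
    have hδ5 : 0 < δ⁻¹ ^ 5 := by positivity
    have h1 : R₀⁻¹ * (250 * δ⁻¹ ^ 5) < 1 / 2 := by
      rw [inv_mul_lt_iff₀ hR₀0]
      rw [hR₀]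
      nlinarith
    linarith
  -- the particle `m ≠ i` with the largest first coordinate
  obtain ⟨m, hm, hmax⟩ := Finset.exists_max_image (Finset.univ.erase i) (fun k => x k 0)
    ⟨j, Finset.mem_erase.2 ⟨hji, Finset.mem_univ _⟩⟩
  have hmi : m ≠ i := Finset.ne_of_mem_erase hm
  have hmax' : ∀ k, k ≠ i → x k 0 ≤ x m 0 := fun k hk =>
    hmax k (Finset.mem_erase.2 ⟨hk, Finset.mem_univ _⟩)
  obtain ⟨hsum, hfar⟩ := hge_sum_lennardJones_relocate_le x hmi hmax'
  set y : (EuclideanSpace ℝ (Fin 3)) := x m + EuclideanSpace.single 0 1 with hy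
  have hy' : ∀ k, k ≠ i → y ≠ x k := fun k hk h => by
    have := hfar k hk
    rw [h, dist_self] at this
    exact absurd this (by norm_num)
  -- the modified configuration consists of distinct points
  have hinj : Function.Injective (Function.update x i y) := by
    intro a b hab
    by_cases ha : a = i <;> by_cases hb : b = i
    · exact ha.trans hb.symm
    · subst ha
      rw [Function.update_self, Function.update_of_ne hb] at hab
      exact absurd hab (hy' b hb)
    · subst hb
      rw [Function.update_self, Function.update_of_ne ha] at hab
      exact absurd hab.symm (hy' a ha)
    · rw [Function.update_of_ne ha, Function.update_of_ne hb] at hab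
      exact hx.1 hab
  have hle : interactionEnergy lennardJones x ≤
      interactionEnergy lennardJones (Function.update x i y) := by
    rw [hx.2]
    exact groundStateEnergy_lennardJones_le hinj
  have hdiff := sum_siteEnergy_update_sub lennardJones x i y
  have h2 := two_mul_interactionEnergy lennardJones x
  have h2' := two_mul_interactionEnergy lennardJones (Function.update x i y)
  linarith

end Summit.AtomisticToContinuum.Crystallization.Theorems

end
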